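import Literature.AlgebraicGeometry.AbelianSchemes.PolarizedTripleRigidityAnyBase
import Literature.AlgebraicGeometry.Motives.AbelianVarietyFGSubfieldDescentDivisor
import Literature.AlgebraicGeometry.Motives.CartierDivisorAmpleSpread
import Mathlib.FieldTheory.AlgebraicClosure
import HarnessLib

/-!
# TRIPLES ARE RIGID — the (L3) DESCENT: the field brick of the lemma of Serre over an ARBITRARY algebraically closed field of
# characteristic `0`, from a model over a finitely generated field ([Milne1986AbelianVarieties] Prop. 17.5; [MumfordFogartyKirwan1994] p. 139)

Layer `Literature/AlgebraicGeometry/AbelianSchemes` (decls in `Literature.AlgebraicGeometry.Motives.AbelianVariety`), cell hodgecm-mathlib,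
F-DAG leaf F-7 (7b) / F-8 (8e), layer (L3), sequel of F4 ★ `PolarizedTripleRigidityAnyBase` (seat B-p03 (g17)).

§1 `iso_hom_eq_id_of_ampleSpread`: for an algebraically closed field `Ω` of characteristic `0` of ANY cardinality, an automorphism `e`
of an abelian variety `B / Ω` fixing the Néron–Severi class of an ample divisor `Θ` (the Pic⁰ clause, in the translation-invariance
currency of ★ F3 `HomogeneousDivisorClassTransfer`) and the `N`-torsion (`N ≥ 3`) is the identity — GIVEN the ampleness-spread property
`hF2` for abelian varieties over subfields of `Ω` (file F2 `Motives/CartierDivisorAmpleSpread`, B-p12 (g15): an effective Cartier divisor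
class ample after base change to `Ω` is ample after base change to every intermediate field containing a finite set `s′`).  Proof: descend
`(B, e, e⁻¹, Θ)` to `k₁ = ℚ(s)` (★ F1 `exists_finset_intermediateField_descent_end_divisor`; `e₁` is an isomorphism by ★
`Hom.baseChange_injective`), let `k₂ ⊆ Ω` be the algebraic closure of `k₁(s′)` in `Ω` (Mathlib `algebraicClosure`, `IsAlgClosure`;
countable by `IntermediateField.cardinalMk_adjoin_le` and `Algebra.IsAlgebraic.cardinalMk_le_max`), and apply ★ `iso_hom_eq_id_of_model`
(one tower step `k₁ ⊆ k₂ ⊆ Ω`, ★ F3, ★ `Motives.AbelianVarietyAutBaseChangeTransfer`, and the countable brick ★ `iso_hom_eq_id_of_countable`,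
itself resting on the brick over `ℂ` ★ `HodgeTheory.AbelianVarietyPolarizedAutomorphismRigidity`).  §2–§3 (ed.2) discharge `hF2` by F2 ★
`CartierDivisor.IsAmple.exists_finset_forall_isAmple_classPullback` and record the UNCONDITIONAL rigidity of level-`N ≥ 3` polarized triples over every locally Noetherian ℚ-scheme (★ `eq_id_and_hat_eq_id_of_over_rat`).

HC_CM is proved only modulo the 7 printed citations until rung 0 closes; this file discharges none of them.

## References
* [Milne1986AbelianVarieties] J. S. Milne, Abelian varieties, in Cornell–Silverman (1986), Prop. 17.5 (p. 139).
* [MumfordFogartyKirwan1994] D. Mumford, J. Fogarty, F. Kirwan, *Geometric Invariant Theory*, 3rd ed. (1994), Ch. 7 §3, remark after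
  Thm. 7.9 (p. 139).
* [MumfordAV1970] D. Mumford, *Abelian Varieties* (1970), §8.
* [Deligne1971TravauxShimura] P. Deligne, Travaux de Shimura, Sém. Bourbaki 389 (1971), 4.16 (p. 150).
-/

set_option autoImplicit false

noncomputable section

open CategoryTheory CategoryTheory.Limits AlgebraicGeometry

namespace Literature.AlgebraicGeometry.Motives

namespace AbelianVariety

open Literature.AlgebraicGeometry.AbelianVarieties Literature.AlgebraicGeometry.AbelianVarieties.AbelianVariety

/-! ### §1 The field brick over an arbitrary algebraically closed field of characteristic `0`, given the ampleness-spread property -/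

/-- **THE FIELD BRICK OF THE LEMMA OF SERRE over an arbitrary algebraically closed field `Ω` of characteristic `0`, given the
ampleness-spread property `hF2`** (file F2 `Motives/CartierDivisorAmpleSpread`): descend `(B, e, e⁻¹, Θ)` to the finitely generated field
`k₁ = ℚ(s)` (★ F1 `exists_finset_intermediateField_descent_end_divisor`; `e₁` is an isomorphism by faithfulness ★ `Hom.baseChange_injective`),
spread the ampleness of `Θ₁ ⊗ Ω ∼ ε^*Θ` to every field of the tower containing a finite `s′` (`hF2`), take `k₂ :=` the algebraic closure of
`k₁(s′)` in `Ω` (Mathlib `algebraicClosure.isAlgClosure`; countable by `IntermediateField.cardinalMk_adjoin_le` +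
`Algebra.IsAlgebraic.cardinalMk_le_max`), and apply ★ `iso_hom_eq_id_of_model`.
[cite: Milne1986AbelianVarieties, Prop. 17.5 (b) (p. 139)] [cite: MumfordFogartyKirwan1994, Ch. 7 §3, remark after Theorem 7.9 (p. 139)]
[cite: MumfordAV1970, §8 (pp. 74–75)] -/
theorem iso_hom_eq_id_of_ampleSpread {Ω : Type} [Field Ω] [IsAlgClosed Ω] [CharZero Ω] {N : ℕ} (hN : 3 ≤ N)
    (hF2 : ∀ {K : Type} [Field K] [Algebra K Ω] (A : AbelianVariety K) [IsIntegral A.X.left] (D : CartierDivisor A.X.left),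
      (D.classPullback (pullback.fst A.X.hom (bcSpec K Ω))).IsAmple →
      ∃ s' : Finset Ω, ∀ (L : Type) [Field L] [Algebra K L] [Algebra L Ω] [IsScalarTower K L Ω],
        (↑s' : Set Ω) ⊆ Set.range (algebraMap L Ω) → (D.classPullback (pullback.fst A.X.hom (bcSpec K L))).IsAmple)
    (B : AbelianVariety Ω) (e : B ≅ B) (Θ : CartierDivisor B.X.left) (hΘ : Θ.IsAmple)
    (hNS : haveI := isDominant_toSchemeHom_iso_hom e
      ∀ Q : B.Points Ω, ((Θ + -Θ.pullback (Hom.toSchemeHom e.hom)).pullback (B.translation Q).left).LinEquiv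
        (Θ + -Θ.pullback (Hom.toSchemeHom e.hom)))
    (htor : ∀ P : B.Points Ω, P ^ N = 1 → AlgPoints.map e.hom.hom.hom.hom P = P) : e.hom = 𝟙 B := by
  classical
  -- §1 the model over the finitely generated field `k₁ := ℚ(s)`
  obtain ⟨s, hs⟩ := exists_finset_intermediateField_descent_end_divisor (F := ℚ) B (J := Fin 2) ![e.hom, e.inv] Θ
  let k₁ : IntermediateField ℚ Ω := IntermediateField.adjoin ℚ (↑s : Set Ω)
  obtain ⟨B₁, ε, r₁, _, _, Θ₁, hr, hΘ₁⟩ := hs k₁ (IntermediateField.subset_adjoin ℚ _)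
  -- the descended automorphism `e₁ = (r₁ 0, r₁ 1)`
  have hbc : ∀ (u : B₁ ⟶ B₁) (v : B ⟶ B), Hom.baseChange Ω u ≫ ε.hom = ε.hom ≫ v →
      Hom.baseChange Ω u = ε.hom ≫ v ≫ ε.inv := fun u v h => by
    rw [← Category.assoc, ← h, Category.assoc, ε.hom_inv_id, Category.comp_id]
  have hr0 := hbc _ _ (hr 0)
  have hr1 := hbc _ _ (hr 1)
  simp only [Matrix.cons_val_zero, Matrix.cons_val_one] at hr0 hr1
  have h01 : r₁ 0 ≫ r₁ 1 = 𝟙 B₁ := Hom.baseChange_injective Ω (by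
    rw [Hom.baseChange_comp, Hom.baseChange_id, hr0, hr1]
    simp)
  have h10 : r₁ 1 ≫ r₁ 0 = 𝟙 B₁ := Hom.baseChange_injective Ω (by
    rw [Hom.baseChange_comp, Hom.baseChange_id, hr0, hr1]
    simp)
  let e₁ : B₁ ≅ B₁ := ⟨r₁ 0, r₁ 1, h01, h10⟩
  have hconj : Hom.baseChange Ω e₁.hom ≫ ε.hom = ε.hom ≫ e.hom := by
    have := hr 0
    simpa only [Matrix.cons_val_zero] using this
  -- projections, dominance, the divisor clause in pull-back form
  haveI : IsIso (Hom.toSchemeHom ε.hom) :=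
    ⟨Hom.toSchemeHom ε.inv, by change Hom.toSchemeHom (ε.hom ≫ ε.inv) = _; rw [ε.hom_inv_id]; rfl, by
      change Hom.toSchemeHom (ε.inv ≫ ε.hom) = _; rw [ε.inv_hom_id]; rfl⟩
  haveI := isDominant_toSchemeHom_iso_hom ε
  let pr₁Ω : (B₁.baseChange Ω).X.left ⟶ B₁.X.left := pullback.fst B₁.X.hom (bcSpec k₁ Ω)
  have hpr₁Ω : pr₁Ω = pullback.fst B₁.X.hom (bcSpec k₁ Ω) := rfl
  have hdomΩ : IsDominant pr₁Ω := by
    change IsDominant (baseChangeHomFst (algebraMap k₁ Ω) B₁.X)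
    exact isDominant_baseChangeHomFst_along (algebraMap k₁ Ω) B₁
  haveI := hdomΩ
  have hΘ₁' : (Θ.pullback (Hom.toSchemeHom ε.hom)).LinEquiv (Θ₁.pullback pr₁Ω) :=
    ((CartierDivisor.classPullback_linEquiv_pullback (Hom.toSchemeHom ε.hom) Θ).symm.trans hΘ₁).trans
      (CartierDivisor.classPullback_linEquiv_pullback pr₁Ω Θ₁)
  have hampΩ : (Θ₁.pullback pr₁Ω).IsAmple := hΘ₁'.isAmple (hΘ.pullback (Hom.toSchemeHom ε.hom))
  have hampΩ' : (Θ₁.classPullback (pullback.fst B₁.X.hom (bcSpec k₁ Ω))).IsAmple :=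
    (CartierDivisor.classPullback_linEquiv_pullback pr₁Ω Θ₁).symm.isAmple hampΩ
  -- §2 spread the ampleness: the finite set `s′`
  obtain ⟨s', hs'⟩ := hF2 B₁ Θ₁ hampΩ'
  -- §3 the countable algebraically closed field `k₂ := algebraic closure of k₁(s′) in Ω` (as an intermediate field over `k₁`)
  let k₁' : IntermediateField (↥k₁) Ω := IntermediateField.adjoin (↥k₁) (↑s' : Set Ω)
  let K₂ : IntermediateField (↥k₁) Ω := (algebraicClosure (↥k₁') Ω).restrictScalars (↥k₁)
  haveI : IsAlgClosed (↥K₂) := (IsAlgClosure.isAlgClosed (↥k₁') (K := ↥(algebraicClosure (↥k₁') Ω)) :)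
  haveI : CharZero (↥K₂) := (RingHom.charZero_iff (algebraMap (↥K₂) Ω).injective).mpr inferInstance
  haveI : FaithfulSMul (↥k₁') (↥(algebraicClosure (↥k₁') Ω)) :=
    (faithfulSMul_iff_algebraMap_injective _ _).mpr fun x y hxy =>
      Subtype.ext (congrArg (fun z : ↥(algebraicClosure (↥k₁') Ω) => (z : Ω)) hxy)
  haveI : Module.IsTorsionFree (↥k₁') (↥(algebraicClosure (↥k₁') Ω)) := FaithfulSMul.to_isTorsionFree ..
  haveI : Countable (↥K₂) := by
    rw [← Cardinal.mk_le_aleph0_iff]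
    have h₁ : Cardinal.mk (↥k₁) ≤ Cardinal.aleph0 :=
      (IntermediateField.cardinalMk_adjoin_le ℚ (↑s : Set Ω)).trans (by simp)
    have h₂ : Cardinal.mk (↥k₁') ≤ Cardinal.aleph0 :=
      (IntermediateField.cardinalMk_adjoin_le (↥k₁) (↑s' : Set Ω)).trans (by simp [h₁])
    exact (Algebra.IsAlgebraic.cardinalMk_le_max (↥k₁') (↥(algebraicClosure (↥k₁') Ω))).trans (by simp [h₂])
  -- `s′ ⊆ K₂`
  have hsub : (↑s' : Set Ω) ⊆ Set.range (algebraMap (↥K₂) Ω) := by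
    intro x hx
    have hx₁ : x ∈ k₁' := IntermediateField.subset_adjoin (↥k₁) _ hx
    exact ⟨⟨x, IntermediateField.algebraMap_mem (algebraicClosure (↥k₁') Ω) ⟨x, hx₁⟩⟩, rfl⟩
  -- ampleness over `K₂`
  have hampK₂ := hs' (↥K₂) hsub
  let pr₁₂ : (B₁.baseChange (↥K₂)).X.left ⟶ B₁.X.left := pullback.fst B₁.X.hom (bcSpec k₁ (↥K₂))
  have hpr₁₂ : pr₁₂ = pullback.fst B₁.X.hom (bcSpec k₁ (↥K₂)) := rfl
  have hdom₂ : IsDominant pr₁₂ := by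
    change IsDominant (baseChangeHomFst (algebraMap k₁ (↥K₂)) B₁.X)
    exact isDominant_baseChangeHomFst_along (algebraMap k₁ (↥K₂)) B₁
  haveI := hdom₂
  have hΘ₂ : (Θ₁.pullback pr₁₂).IsAmple := (CartierDivisor.classPullback_linEquiv_pullback pr₁₂ Θ₁).isAmple hampK₂
  -- §4 the model theorem
  exact iso_hom_eq_id_of_model (k₁ := ↥k₁) (k₂ := ↥K₂) hN e Θ hNS htor ε e₁ hconj Θ₁ pr₁Ω hpr₁Ω pr₁₂ hpr₁₂ hΘ₁' hΘ₂

/-! ### §2 (ed.2) The field brick UNCONDITIONALLY — the ampleness-spread property is F2 ★ `Motives/CartierDivisorAmpleSpread`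
(`CartierDivisor.IsAmple.exists_finset_forall_isAmple_classPullback`, B-p12 (g15)) -/

/-- **THE FIELD BRICK OF THE LEMMA OF SERRE at EVERY algebraically closed field `Ω` of characteristic `0`** ([Milne1986AbelianVarieties]
Prop. 17.5 (b) in the tree's currency): an automorphism `e` of an abelian variety `B / Ω` such that `e^*Θ - Θ` is translation-invariant
up to linear equivalence for an ample effective Cartier divisor `Θ` (the Pic⁰ / Néron–Severi clause) and which fixes the `N`-torsion
points, `N ≥ 3`, is the identity.  `iso_hom_eq_id_of_ampleSpread` with its hypothesis discharged by F2 ★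
`CartierDivisor.IsAmple.exists_finset_forall_isAmple_classPullback` (at `P := A.X`).  The finite order that [Milne1986AbelianVarieties]
17.5 (a) takes from the positivity of the Rosati involution enters through the brick over `ℂ` (★
`HodgeTheory.AbelianVariety.forall_iso_hom_eq_id_of_three_le`, analytic), reached by descent (★ F1, F2, this file) and ascent (★ F3, F4).
[cite: Milne1986AbelianVarieties, Prop. 17.5 (p. 139)] [cite: MumfordFogartyKirwan1994, Ch. 7 §3, remark after Theorem 7.9 (p. 139)]
[cite: MumfordAV1970, §21 Thm. 5 (p. 207) and §8 (pp. 74–75)] -/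
theorem iso_hom_eq_id_of_isAlgClosed {Ω : Type} [Field Ω] [IsAlgClosed Ω] [CharZero Ω] {N : ℕ} (hN : 3 ≤ N)
    (B : AbelianVariety Ω) (e : B ≅ B) (Θ : CartierDivisor B.X.left) (hΘ : Θ.IsAmple)
    (hNS : haveI := isDominant_toSchemeHom_iso_hom e
      ∀ Q : B.Points Ω, ((Θ + -Θ.pullback (Hom.toSchemeHom e.hom)).pullback (B.translation Q).left).LinEquiv
        (Θ + -Θ.pullback (Hom.toSchemeHom e.hom)))
    (htor : ∀ P : B.Points Ω, P ^ N = 1 → AlgPoints.map e.hom.hom.hom.hom P = P) : e.hom = 𝟙 B :=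
  iso_hom_eq_id_of_ampleSpread hN
    (fun A _ D h => CartierDivisor.IsAmple.exists_finset_forall_isAmple_classPullback A.X D h) B e Θ hΘ hNS htor

end AbelianVariety

end Literature.AlgebraicGeometry.Motives

namespace Literature.AlgebraicGeometry.AbelianSchemes

namespace PolarizedAbelianSchemeWithLevel

open Literature.AlgebraicGeometry.Motives

variable {g N : ℕ} {δ : Fin g → ℕ}

/-! ### §3 (ed.2) TRIPLES ARE RIGID over every locally Noetherian ℚ-scheme — unconditionally -/

/-- **LEVEL-`N ≥ 3` POLARIZED ABELIAN SCHEMES ARE RIGID over every locally Noetherian ℚ-scheme**: a pull-back datum of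
`P = (A, Â, 𝒫, λ, level)` to itself over `𝟙 S` is the identity pair — the automorphism group of a level-`N ≥ 3` polarized triple is
trivial ([MumfordFogartyKirwan1994] Ch. 7 §3, remark after Thm. 7.9; [Deligne1971TravauxShimura] 4.16), which is what makes the Siegel
moduli functor `𝒜_{g,δ,N}` a sheaf with representable diagonal and its fine moduli scheme meaningful over ALL locally Noetherian ℚ-schemes
(cell hodgecm-mathlib (F) `SiegelFineModuliScheme.classify`, director s220).  ★ `eq_id_and_hat_eq_id_of_over_rat` with the field brick
★ `AbelianVariety.iso_hom_eq_id_of_isAlgClosed` at every algebraically closed residue-field closure.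
[cite: MumfordFogartyKirwan1994, Ch. 7 §3, remark after Theorem 7.9 (p. 139)] [cite: Deligne1971TravauxShimura, 4.16 (p. 150)]
[cite: Milne1986AbelianVarieties, Prop. 17.5 (p. 139)] -/
theorem eq_id_and_hat_eq_id_of_three_le {S : Scheme.{0}} [IsLocallyNoetherian S] (f : S ⟶ Spec (.of ℚ)) (hN : 3 ≤ N)
    (P : PolarizedAbelianSchemeWithLevel g N δ S) {G : P.A.X.left ⟶ P.A.X.left} {Ĝ : P.D.hat.X.left ⟶ P.D.hat.X.left}
    (h : P.IsBaseChangeVia P (𝟙 S) G Ĝ) : G = 𝟙 P.A.X.left ∧ Ĝ = 𝟙 P.D.hat.X.left :=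
  eq_id_and_hat_eq_id_of_over_rat f P
    (fun _ _ _ _ B e Θ hΘ hNS htor => AbelianVariety.iso_hom_eq_id_of_isAlgClosed hN B e Θ hΘ hNS htor) h

/-- **… hence pull-back data of level-`N ≥ 3` polarized triples are UNIQUE over every locally Noetherian ℚ-scheme** (the isomorphisms
produced by `classify` are unique, so local classifying data glue — [MumfordFogartyKirwan1994] Prop. 7.6 / remark after Thm. 7.9),
unconditionally: ★ `IsBaseChangeVia.unique_of_over_rat` with the field brick ★ `AbelianVariety.iso_hom_eq_id_of_isAlgClosed`.
[cite: MumfordFogartyKirwan1994, Ch. 7 §2 Proposition 7.6 (pp. 136–138); §3, remark after Theorem 7.9 (p. 139)]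
[cite: Deligne1971TravauxShimura, 4.16 (p. 150)] -/
theorem IsBaseChangeVia.unique_of_three_le {S T : Scheme.{0}} [IsLocallyNoetherian T] (fT : T ⟶ Spec (.of ℚ)) (hN : 3 ≤ N)
    {P : PolarizedAbelianSchemeWithLevel g N δ S} {P' : PolarizedAbelianSchemeWithLevel g N δ T}
    {f : T ⟶ S} {G₁ G₂ : P'.A.X.left ⟶ P.A.X.left} {Ĝ₁ Ĝ₂ : P'.D.hat.X.left ⟶ P.D.hat.X.left}
    (h₁ : P'.IsBaseChangeVia P f G₁ Ĝ₁) (h₂ : P'.IsBaseChangeVia P f G₂ Ĝ₂) : G₁ = G₂ ∧ Ĝ₁ = Ĝ₂ :=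
  IsBaseChangeVia.unique_of_over_rat fT
    (fun _ _ _ _ B e Θ hΘ hNS htor => AbelianVariety.iso_hom_eq_id_of_isAlgClosed hN B e Θ hΘ hNS htor) h₁ h₂

end PolarizedAbelianSchemeWithLevel

end Literature.AlgebraicGeometry.AbelianSchemes
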